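import Summits.AnomalousDissipation.AnomalousDissipation.Theorems.SolenoidalFractalHomogenisationLagrangianStepZ7GlueDefs
import HarnessLib

/-!
# K1L_D (stmt-AnomalousDissipation-27980): the (V_mod) obligation as the EULERIAN REFRESH-PIECE LOSS BOUND — «EulerPiece» texts (definitions only)
(Summits-side definitions file of route `SolenoidalFractalHomogenisation`; review lane; prover lead-k1l-onelevel-p1 g6 = pen of the (ℓ3) text, tenure RULING D27-10
on memo L17 `Cruxes/…/Lines/onelevel-L17-eulerpiece-opinion.md`; text author prover ad-sawtooth-k1loc-p1 g14, preview `EulerPiecePreview-k1locp1g14.lean`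
sha16 a550aab12163fba6, certifier planner ad-ideate-p5 g14 3-probe PASS 2026-08-29T07:04:07Z.)

RULING D27-10 (T2 option (iii) «EulerPiece» = the TARGET SHAPE of the modulated stage (ℓ3)): the registered (V ∧ W7 ⇒ V_modECW) stub `stub_Vmod_of_VRH`
(v26) and the conjugacy facts (α₁)(α₂) of `cellInputs_alphaBeta_textP` are consumed by the §9z glue ONLY through `Z7Glue.eulerian_pieceW` (l.182 / l.234 of
`cellInputs_BIL_ofEH`), whose output is the Eulerian refresh-piece loss bound below; stating THAT as the obligation removes the abstract modulation datum
`IsModulation G` and the abstract distorted propagators from the registered interface (frames become a METHOD inside the proof; finding F-p1g14-4 dissolves).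
* `SlowVectorClauseEulerPiece W M hM c Φ lo hi Λ β σ C ν₀ K θ₁ ϱ₁` — for every carrier `E` of design `W.stretch M`, gain `c`, every level `m` in the
  quasi-static regime (`cellVisc (m+1) < ν₀`, `⌈K/ν⌉ ≤ N(m+1)`, `θ(m+1) ≤ θ₁`, `N m ≤ ϱ₁·N(m+1)`), every window tensor `S` (and its coarse image) and the
  two Eulerian propagators (`Um1` true, `Um` coarse), on every refresh piece `[s,t]`, `s = j·refresh (m+1)`, `s < t ≤ s + refresh (m+1)`, `t ≤ 1`:
  `|⟪(Um1 − Um)(s,t) x, y⟫| ≤ η·√lossFwd (Um s t) x·√lossAdj (Um s t) y` for ALL `x y : V2`,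
  `η = C(C(ν^σ + (⌈K/ν⌉/N(m+1))^σ + θ(m+1)^σ + (N m/N(m+1))^σ) + (min 1 ((M·Wp/ν)/(a(m+1)(t−s))))^σ)` (p1 g14's text VERBATIM);
* **`Vmod_E_textH e`** — the v27 candidate registered shape: the guards of §9z, `ν₀ ≤ 1`, (V) `SlowVectorClauseF … σ C ν₀ K`, the W7 family
  `(∀ Kb ≥ 1, ∃ CK ≥ 1, ∃ cK > 0, ∃ νh > 0, HighLabelDecayW W M hM lo hi Λ β νh Kb CK cK)` (RULING D27-9: same binder, same position as in `stub_Vmod_of_VRH`)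
  ⟹ `∃ θ₁ > 0, ∃ ϱ₁ > 0, ∃ Cm ≥ C, SlowVectorClauseEulerPiece … (e σ) Cm ν₀ K θ₁ ϱ₁` at the registry's exponent map `e` (v26 token `e σ = min (σ/2) (1/2)`).
Companions (proof files): `…Z7GlueEuler` (`cellInputs_BIL_ofEuler e he : Vmod_E_textH e → cellInputs_alphaBeta_textP → §9z` — what the registry move
`stub_Vmod_of_VRH ↦ stub_Vmod_E` composes through) and `…Z7GlueEulerOfVRH` (`vmod_E_of_VRH` — the superseded-by-weaker certificate).
Definitions only; NOT a proof of anything; K1L_D open; AD NOT proved; rung F-D1.A0.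
AMENDMENT 1 (same seat, finding F-lead-g6-1, see the last section): TEXT OF RECORD = `SlowVectorClauseEulerPieceT` / `Vmod_E_textHT` (carrier template binders added).
-/

set_option linter.dupNamespace false

noncomputable section

namespace Summit.AnomalousDissipation.AnomalousDissipation.Theorems.SolenoidalFractalHomogenisation.LagrangianStep.Z7Glue

open Literature.Analysis Literature.Analysis.FluidPDE Literature.Analysis.FunctionSpaces
open MeasureTheory Set
open scoped InnerProductSpace
open Literature.Analysis.FluidPDE.LatticeShear (LagrangianLatticeCarrier LatticeWord)
open Summit.AnomalousDissipation.AnomalousDissipation.Theorems.SolenoidalFractalHomogenisation.LagrangianStep.CellClauseMod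

/-- **(V_E) — the slow-vector MODULATED clause stated on the Eulerian refresh piece** («EulerPiece», text of prover ad-sawtooth-k1loc-p1 g14 VERBATIM;
RULING D27-10).  For every carrier `E` of the class with design word `W.stretch M`, gain `c`, every level `m` whose cell viscosity `ν = cellVisc (m+1)` is
quasi-static (`ν < ν₀`, `⌈K/ν⌉ ≤ N(m+1)`), small distortion `θ(m+1) ≤ θ₁` and scale ratio `N m ≤ ϱ₁ N(m+1)`, every window tensor `S` (with the coarse image
`Φ ν S` in the same window), the TRUE propagator `Um1` (drift `partialSum (m+1)`, tensor `kbar(m+1)•S`) and the COARSE one `Um` (drift `partialSum m`,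
renormalised tensor), and every refresh piece `[s,t]`, `s = j·refresh(m+1)`, `t ≤ s + refresh(m+1)`, `t ≤ 1`: for all `x y : V2`,
`|⟪(Um1 − Um)(s,t) x, y⟫| ≤ η·√lossFwd (Um s t) x·√lossAdj (Um s t) y`,
`η = C(C(ν^σ + (⌈K/ν⌉/N(m+1))^σ + θ(m+1)^σ + (N m/N(m+1))^σ) + (min 1 ((M·Wp/ν)/(a(m+1)(t−s))))^σ)`.
[cite: ArmstrongVicol2025, §4.1 (PDF p. 34: the distortion-adapted comparison problem, one refresh window)] -/
def SlowVectorClauseEulerPiece {k : ℕ} (W : LatticeWord k) (M : ℝ) (hM : 0 < M) (c : ℝ)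
    (Φ : ℝ → Torus.Visc4 (Fin 3) → Torus.Visc4 (Fin 3)) (lo hi Λ β σ C ν₀ K θ₁ ϱ₁ : ℝ) : Prop :=
  ∀ E : LagrangianLatticeCarrier k, E.design = W.stretch M hM → E.gain = c → E.LPermissible → E.Regular →
  ∀ m : ℕ, E.cellVisc (m + 1) < ν₀ → (⌈K / E.cellVisc (m + 1)⌉₊ : ℝ) ≤ E.N (m + 1) → E.θ (m + 1) ≤ θ₁ → (E.N m : ℝ) ≤ ϱ₁ * E.N (m + 1) →
  ∀ S : Torus.Visc4 (Fin 3), Torus.OddSmall S β → (∃ lam ∈ Set.Icc (1:ℝ) Λ, Torus.NearIso S (lo / lam) (hi * lam)) →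
    Torus.OddSmall (Φ (E.cellVisc (m + 1)) S) β → (∃ lam ∈ Set.Icc (1:ℝ) Λ, Torus.NearIso (Φ (E.cellVisc (m + 1)) S) (lo / lam) (hi * lam)) →
  ∀ Um Um1 : ℝ → ℝ → (V2 →L[ℝ] V2),
    Torus.IsPropagator 1 (E.partialSum m) (E.kbar m • renormStep (Φ (E.cellVisc (m + 1))) (E.gain / E.cellVisc (m + 1) ^ 2) S) Um →
    Torus.IsPropagator 1 (E.partialSum (m + 1)) (E.kbar (m + 1) • S) Um1 →
  ∀ (j : ℕ) (s t : ℝ), s = (j : ℝ) * E.refresh (m + 1) → s < t → t ≤ s + E.refresh (m + 1) → t ≤ 1 →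
  ∀ x y : V2,
    |⟪Um1 s t x - Um s t x, y⟫_ℝ|
      ≤ (C * (C * (E.cellVisc (m + 1) ^ σ + ((⌈K / E.cellVisc (m + 1)⌉₊ : ℝ) / E.N (m + 1)) ^ σ + E.θ (m + 1) ^ σ
            + ((E.N m : ℝ) / E.N (m + 1)) ^ σ)
          + (min 1 ((M * W.period / E.cellVisc (m + 1)) / (E.a (m + 1) * (t - s)))) ^ σ))
        * Real.sqrt (lossFwd (Um s t) x) * Real.sqrt (lossAdj (Um s t) y)

/-- **`Vmod_E_textH e` — the (ℓ3) obligation as the v27 CANDIDATE registered shape** (RULING D27-10; W7 binder per RULING D27-9): the guards of the §9z text,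
`ν₀ ≤ 1`, the slow-vector cell clause (V) `SlowVectorClauseF` at `(σ, C)`, and the §9z text's own W7 high-label-decay family imply, for some `θ₁ > 0`,
`ϱ₁ > 0` and own constant `Cm ≥ C`, the Eulerian refresh-piece clause `SlowVectorClauseEulerPiece` at the registry's exponent `e σ`. -/
def Vmod_E_textH (e : ℝ → ℝ) : Prop := ∀ k (W : LatticeWord k) (M : ℝ) (hM : 0 < M) (c : ℝ), 0 < c →
  ∀ (Φ : ℝ → Torus.Visc4 (Fin 3) → Torus.Visc4 (Fin 3)) (lo hi Λ β σ C ν₀ K : ℝ),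
    0 < lo → lo ≤ 1 → 1 ≤ hi → 1 < Λ → 0 ≤ β → 0 < σ → 0 ≤ C → 0 < ν₀ → ν₀ ≤ 1 → 0 < K →
    SlowVectorClauseF W M hM c Φ lo hi Λ β σ C ν₀ K →
    (∀ Kb : ℝ, 1 ≤ Kb → ∃ CK : ℝ, 1 ≤ CK ∧ ∃ cK > (0:ℝ), ∃ νh > (0:ℝ), HighLabelDecayW W M hM lo hi Λ β νh Kb CK cK) →
    ∃ θ₁ > (0:ℝ), ∃ ϱ₁ > (0:ℝ), ∃ Cm : ℝ, C ≤ Cm ∧ SlowVectorClauseEulerPiece W M hM c Φ lo hi Λ β (e σ) Cm ν₀ K θ₁ ϱ₁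

/-! ## Amendment 1 (lead-k1l-onelevel-p1 g6, finding F-lead-g6-1): the CASCADE-GLOBAL binders of the frame method

`SlowVectorClauseEulerPiece` quantifies over carriers whose LOWER levels may be arbitrarily distorted: `LPermissible` bounds `strain i` by `θ (i+1)`
but not `θ (i+1)` itself, and asks `N m² ≤ N (m+1)` of nobody.  Every frame lemma of the α-lane — `FrameForm.abs_frameG_sub_one_le_strain_closed`,
`FrameForm.isModulation_frameG_closed` (p704979) / `isModulation_frameG_closed_pos` (p707880), K8-5 `FrameForm.abs_partialDeriv_frameG_le` (p707845), the
analytic tower — consumes the two §9z carrier-template binders `(∀ m, E.N m ^ 2 ≤ E.N (m + 1))` (super-geometric separation) and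
`(∀ m, E.θ (m + 1) * ((E.N (m + 1) : ℝ) / E.N m) ^ (1 / 16 : ℝ) ≤ θ₀)` (strain template (T4), `θ₀` below a design ceiling): the distortion of the flow of
`b_{≤m}` is controlled only if EVERY lower level is.  So the weaker-ness certificate `vmod_E_of_VRH` is not provable against the amendment-0 text, and the
text of record for the (ℓ3) obligation is the amended one below: the per-level `E.θ (m + 1) ≤ θ₁` is REPLACED by the template at `θ₁` (which implies it,
`FrameForm.theta_le_of_template`) and the separation binder is ADDED, both VERBATIM from the §9z text (they are in scope at the glue's call sites: `hN2`, `hT4`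
with `θ₀ ≤ θ₁`).  Amendment-0 `SlowVectorClauseEulerPiece` / `Vmod_E_textH` stay as declared (history; formally STRONGER: `EulerPiece → EulerPieceT`);
nobody attempts them. -/

/-- **(V_E)ᵀ — EulerPiece with the carrier template** (amendment 1, finding F-lead-g6-1): `SlowVectorClauseEulerPiece` with the super-geometric separation
`∀ m, N m² ≤ N (m+1)` ADDED and the per-level distortion condition replaced by the strain TEMPLATE `∀ m, θ(m+1)·(N(m+1)/N m)^{1/16} ≤ θ₁` (both verbatim §9z
carrier binders); everything else — the quasi-static and scale-ratio conditions of the level, the two tensor windows, the two Eulerian propagators, the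
refresh-piece windows `s = jR < t ≤ s + R`, `t ≤ 1`, and the loss-currency conclusion with `η = C(C(ν^σ + (⌈K/ν⌉/N(m+1))^σ + θ(m+1)^σ + (N m/N(m+1))^σ) +
(min 1 ((M·Wp/ν)/(a(m+1)(t−s))))^σ)` — unchanged.
[cite: ArmstrongVicol2025, §4.1 (PDF p. 34) and §5.1 (the distortion of the flows of b_{m−1})] -/
def SlowVectorClauseEulerPieceT {k : ℕ} (W : LatticeWord k) (M : ℝ) (hM : 0 < M) (c : ℝ)
    (Φ : ℝ → Torus.Visc4 (Fin 3) → Torus.Visc4 (Fin 3)) (lo hi Λ β σ C ν₀ K θ₁ ϱ₁ : ℝ) : Prop :=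
  ∀ E : LagrangianLatticeCarrier k, E.design = W.stretch M hM → E.gain = c → E.LPermissible → E.Regular →
  (∀ m, E.N m ^ 2 ≤ E.N (m + 1)) → (∀ m, E.θ (m + 1) * ((E.N (m + 1) : ℝ) / E.N m) ^ (1 / 16 : ℝ) ≤ θ₁) →
  ∀ m : ℕ, E.cellVisc (m + 1) < ν₀ → (⌈K / E.cellVisc (m + 1)⌉₊ : ℝ) ≤ E.N (m + 1) → (E.N m : ℝ) ≤ ϱ₁ * E.N (m + 1) →
  ∀ S : Torus.Visc4 (Fin 3), Torus.OddSmall S β → (∃ lam ∈ Set.Icc (1:ℝ) Λ, Torus.NearIso S (lo / lam) (hi * lam)) →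
    Torus.OddSmall (Φ (E.cellVisc (m + 1)) S) β → (∃ lam ∈ Set.Icc (1:ℝ) Λ, Torus.NearIso (Φ (E.cellVisc (m + 1)) S) (lo / lam) (hi * lam)) →
  ∀ Um Um1 : ℝ → ℝ → (V2 →L[ℝ] V2),
    Torus.IsPropagator 1 (E.partialSum m) (E.kbar m • renormStep (Φ (E.cellVisc (m + 1))) (E.gain / E.cellVisc (m + 1) ^ 2) S) Um →
    Torus.IsPropagator 1 (E.partialSum (m + 1)) (E.kbar (m + 1) • S) Um1 →
  ∀ (j : ℕ) (s t : ℝ), s = (j : ℝ) * E.refresh (m + 1) → s < t → t ≤ s + E.refresh (m + 1) → t ≤ 1 →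
  ∀ x y : V2,
    |⟪Um1 s t x - Um s t x, y⟫_ℝ|
      ≤ (C * (C * (E.cellVisc (m + 1) ^ σ + ((⌈K / E.cellVisc (m + 1)⌉₊ : ℝ) / E.N (m + 1)) ^ σ + E.θ (m + 1) ^ σ
            + ((E.N m : ℝ) / E.N (m + 1)) ^ σ)
          + (min 1 ((M * W.period / E.cellVisc (m + 1)) / (E.a (m + 1) * (t - s)))) ^ σ))
        * Real.sqrt (lossFwd (Um s t) x) * Real.sqrt (lossAdj (Um s t) y)

/-- **`Vmod_E_textHT e` — the (ℓ3) obligation, v27 CANDIDATE registered shape (amendment 1 = text of record)**: the guards of the §9z text, `ν₀ ≤ 1`, (V)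
`SlowVectorClauseF` at `(σ, C)` and the W7 high-label-decay family imply, for some `θ₁ > 0`, `ϱ₁ > 0` and own constant `Cm ≥ C`, the Eulerian refresh-piece
clause WITH THE CARRIER TEMPLATE `SlowVectorClauseEulerPieceT` at the registry's exponent `e σ`.  Consumed by `cellInputs_BIL_ofEuler` (`…Z7GlueEuler`);
implied by v26's `stub_Vmod_of_VRH` (`vmod_E_of_VRH`, `…Z7GlueEulerOfVRH`). -/
def Vmod_E_textHT (e : ℝ → ℝ) : Prop := ∀ k (W : LatticeWord k) (M : ℝ) (hM : 0 < M) (c : ℝ), 0 < c →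
  ∀ (Φ : ℝ → Torus.Visc4 (Fin 3) → Torus.Visc4 (Fin 3)) (lo hi Λ β σ C ν₀ K : ℝ),
    0 < lo → lo ≤ 1 → 1 ≤ hi → 1 < Λ → 0 ≤ β → 0 < σ → 0 ≤ C → 0 < ν₀ → ν₀ ≤ 1 → 0 < K →
    SlowVectorClauseF W M hM c Φ lo hi Λ β σ C ν₀ K →
    (∀ Kb : ℝ, 1 ≤ Kb → ∃ CK : ℝ, 1 ≤ CK ∧ ∃ cK > (0:ℝ), ∃ νh > (0:ℝ), HighLabelDecayW W M hM lo hi Λ β νh Kb CK cK) →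
    ∃ θ₁ > (0:ℝ), ∃ ϱ₁ > (0:ℝ), ∃ Cm : ℝ, C ≤ Cm ∧ SlowVectorClauseEulerPieceT W M hM c Φ lo hi Λ β (e σ) Cm ν₀ K θ₁ ϱ₁

/-- Amendment 0 is formally STRONGER: `SlowVectorClauseEulerPiece → SlowVectorClauseEulerPieceT` (drop the two template binders; the per-level distortion bound
follows from the template along a permissible cascade). -/
theorem slowVectorClauseEulerPieceT_of_eulerPiece {k : ℕ} {W : LatticeWord k} {M : ℝ} {hM : 0 < M} {c : ℝ}
    {Φ : ℝ → Torus.Visc4 (Fin 3) → Torus.Visc4 (Fin 3)} {lo hi Λ β σ C ν₀ K θ₁ ϱ₁ : ℝ}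
    (h : SlowVectorClauseEulerPiece W M hM c Φ lo hi Λ β σ C ν₀ K θ₁ ϱ₁) : SlowVectorClauseEulerPieceT W M hM c Φ lo hi Λ β σ C ν₀ K θ₁ ϱ₁ := by
  intro E hdes hgain hLP hReg _hN2 hT4 m hν hKn hN S hSo hSn hΦSo hΦSn Um Um1 hUm hUm1 j s t hs hst htR ht1 x y
  -- the per-level distortion bound from the template (`2 N m ≤ N (m+1)` is part of `Permissible`)
  have hN2 : ∀ m, 2 * E.N m ≤ E.N (m + 1) := hLP.permissible.2.2.1
  have hNpos : ∀ m, (0 : ℝ) < E.N m := fun m => by exact_mod_cast E.toFractalCarrierData.N_pos m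
  have hNmono : (E.N m : ℝ) ≤ E.N (m + 1) := by
    have h2 : (2 : ℝ) * E.N m ≤ E.N (m + 1) := by exact_mod_cast hN2 m
    linarith [hNpos m]
  have hr : (1 : ℝ) ≤ ((E.N (m + 1) : ℝ) / E.N m) ^ (1 / 16 : ℝ) := Real.one_le_rpow ((one_le_div (hNpos m)).2 hNmono) (by norm_num)
  have hθ : E.θ (m + 1) ≤ θ₁ :=
    calc E.θ (m + 1) = E.θ (m + 1) * 1 := (mul_one _).symm
      _ ≤ E.θ (m + 1) * ((E.N (m + 1) : ℝ) / E.N m) ^ (1 / 16 : ℝ) := mul_le_mul_of_nonneg_left hr (E.θ_pos _).le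
      _ ≤ θ₁ := hT4 m
  exact h E hdes hgain hLP hReg m hν hKn hθ hN S hSo hSn hΦSo hΦSn Um Um1 hUm hUm1 j s t hs hst htR ht1 x y

/-- Hence `Vmod_E_textH e → Vmod_E_textHT e` (amendment 0 implies amendment 1). -/
theorem vmod_E_textHT_of_textH (e : ℝ → ℝ) (h : Vmod_E_textH e) : Vmod_E_textHT e := by
  intro k W M hM c hc Φ lo hi Λ β σ C ν₀ K hlo hlo1 hhi hΛ hβ hσ hC hν₀ hν₀1 hK hV hH
  obtain ⟨θ₁, hθ₁, ϱ₁, hϱ₁, Cm, hCm, hE⟩ := h k W M hM c hc Φ lo hi Λ β σ C ν₀ K hlo hlo1 hhi hΛ hβ hσ hC hν₀ hν₀1 hK hV hH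
  exact ⟨θ₁, hθ₁, ϱ₁, hϱ₁, Cm, hCm, slowVectorClauseEulerPieceT_of_eulerPiece hE⟩

end Summit.AnomalousDissipation.AnomalousDissipation.Theorems.SolenoidalFractalHomogenisation.LagrangianStep.Z7Glue

end
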